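import Mathlib
import HarnessLib
import Summits.RiemannHypothesis.RiemannHypothesis.Theses.WeilParity
import Summits.RiemannHypothesis.RiemannHypothesis.Theses.GroundBarta
import Summits.RiemannHypothesis.RiemannHypothesis.Theorems.WeilParityEvenWinsBeyondArchThreePrimeWindowCompleteOfOddLower
import Summits.RiemannHypothesis.RiemannHypothesis.Theorems.WeilParityEvenWinsBeyondArchFrontierCell7OfBlocks

/-!
# The COMPLETE window `(0, 83/100]` (first window with the prime `5` visible) from one odd bound at `83/100`: the parity order, and the
# residues of `NoParityCrossing` (stmt-RiemannHypothesis-18085), `GroundStateSimpleEven` (stmt-RiemannHypothesis-1526) and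
# `EvenWinsBeyondArch` (stmt-RiemannHypothesis-15432; GroundBarta rung 4 = stmt-RiemannHypothesis-18807) beyond `83/100`

Helper file (`--supports stmt-RiemannHypothesis-18085`), RH-free, pure logic (prover B g8, unit `sr-gb-rung-b`; the `83/100` twin of prover A g10's
`…ThreePrimeWindowCompleteOfOddLower`).  Cell 7 `[4023/5000, 83/100]` of the parity ladder needs ONE number from the deflated Temple ODD block of the
`83/100` cell (prover A g12–g15, certificate C83X consumed block-wise): a lower bound `10⁻¹⁷ < L ≤ ε_od(83/100)` (`weilWindowSimpleEven_upTo_83_of_oddLower`,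
file `…FrontierCell7OfBlocks`, prover A g11; the block is designed for `L = 2·10⁻¹⁷`).  This file records, as implications from that one bound, what the
whole crux chain then says: the strict parity order `ε_ev < ε_od` on `(0, 83/100]`, every ground state a.e. even there, and `NoParityCrossing` /
`GroundStateSimpleEven` / `EvenWinsBeyondArch` (WeilParity and GroundBarta) ⟺ their restrictions to the windows BEYOND `83/100`.  When the odd block
lands (`…DeflationN83OLast` ⇒ `…N83OddCell`), every statement here becomes unconditional by one application; the next U-side is already in the tree
(`trialUpper83sharp : ε(83/100) ≤ 4.83·10⁻¹⁹`, `…Upper83Sharp`).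
-/

set_option linter.dupNamespace false

noncomputable section

open Set MeasureTheory

namespace Summit.RiemannHypothesis.RiemannHypothesis.Theorems.EvenWinsBeyondArch

open Literature.NumberTheory.LFunctions
open Summit.RiemannHypothesis.RiemannHypothesis.Theses.WeilParity
open Summit.RiemannHypothesis.RiemannHypothesis.Theses.WeilGroundState

/-- `(log 2)/2 < 83/100`. [folklore] -/
theorem log_two_half_lt_83 : Real.log 2 / 2 < (83 / 100 : ℝ) :=
  log_two_half_lt_log5half.trans log5half_lt_83

/-- `(log 3)/2 < 83/100`. [folklore] -/
theorem log_three_half_lt_83 : Real.log 3 / 2 < (83 / 100 : ℝ) :=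
  log_three_half_lt_log5half.trans log5half_lt_83

/-- `0 < 83/100` as used below. [folklore] -/
theorem pos_83 : (0 : ℝ) < 83 / 100 := by norm_num

/-- **Strict parity order on the complete window `(0, 83/100]`** from the odd endpoint bound: `ε_ev(a) < ε_od(a)` for
`0 < a ≤ 83/100`. [folklore] -/
theorem weilEvenGroundEnergy_lt_weilOddGroundEnergy_of_le_83_of_oddLower {L : ℝ}
    (hUL : (1 / 100000000000000000 : ℝ) < L) (hL : L ≤ weilOddGroundEnergy ((83 / 100 : ℝ))) {a : ℝ} (ha : 0 < a)
    (hhi : a ≤ (83 / 100 : ℝ)) : weilEvenGroundEnergy a < weilOddGroundEnergy a :=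
  (weilWindowSimpleEven_iff_weilEvenGroundEnergy_lt ha).1 (weilWindowSimpleEven_upTo_83_of_oddLower hUL hL a ha hhi)

/-- **Every ground state at every window `0 < a ≤ 83/100` is a.e. even**, from the odd endpoint bound. [folklore] -/
theorem groundStates_ae_even_of_le_83_of_oddLower {L : ℝ} (hUL : (1 / 100000000000000000 : ℝ) < L)
    (hL : L ≤ weilOddGroundEnergy ((83 / 100 : ℝ))) :
    ∀ a : ℝ, 0 < a → a ≤ (83 / 100 : ℝ) → ∀ u : ℝ → ℂ, IsWeilGroundState a u → u =ᵐ[volume] fun t ↦ u (-t) :=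
  fun a ha hhi ↦ (GroundStateSimpleEven.weilWindowSimpleEven_iff_groundStates_ae_even ha).1
    (weilWindowSimpleEven_upTo_83_of_oddLower hUL hL a ha hhi)

/-- **No tie beyond `83/100` ⟹ `NoParityCrossing`**, from the odd endpoint bound. [folklore] -/
theorem noParityCrossing_of_beyond_83_of_oddLower {L : ℝ} (hUL : (1 / 100000000000000000 : ℝ) < L)
    (hL : L ≤ weilOddGroundEnergy ((83 / 100 : ℝ)))
    (h : ∀ a : ℝ, (83 / 100 : ℝ) < a → weilEvenGroundEnergy a ≠ weilOddGroundEnergy a) : NoParityCrossing := by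
  intro a ha
  rcases le_or_gt a ((83 / 100 : ℝ)) with hle | hlt
  · have ha0 : 0 < a := lt_trans (div_pos (Real.log_pos (by norm_num)) two_pos) ha
    exact (weilEvenGroundEnergy_lt_weilOddGroundEnergy_of_le_83_of_oddLower hUL hL ha0 hle).ne
  · exact h a hlt

/-- **`NoParityCrossing` ⟹ no tie beyond `83/100`** (restriction). [folklore] -/
theorem beyond_83_of_noParityCrossing (h : NoParityCrossing) :
    ∀ a : ℝ, (83 / 100 : ℝ) < a → weilEvenGroundEnergy a ≠ weilOddGroundEnergy a :=
  fun a ha ↦ h a (log_three_half_lt_83.trans ha)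

/-- **Item 18085 after the complete window `(0, 83/100]`: `NoParityCrossing` ↔ no parity tie beyond `83/100`**, from the
odd endpoint bound. [folklore] -/
theorem noParityCrossing_iff_beyond_83_of_oddLower {L : ℝ} (hUL : (1 / 100000000000000000 : ℝ) < L)
    (hL : L ≤ weilOddGroundEnergy ((83 / 100 : ℝ))) :
    NoParityCrossing ↔ ∀ a : ℝ, (83 / 100 : ℝ) < a → weilEvenGroundEnergy a ≠ weilOddGroundEnergy a :=
  ⟨beyond_83_of_noParityCrossing, noParityCrossing_of_beyond_83_of_oddLower hUL hL⟩

/-- **The ladder with the whole window `(0, 83/100]` discharged**: Connes' clause on the tail `a > 83/100` alone proves item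
18085, given the odd endpoint bound. [folklore] -/
theorem noParityCrossing_of_tailSimpleEven_83_of_oddLower {L : ℝ} (hUL : (1 / 100000000000000000 : ℝ) < L)
    (hL : L ≤ weilOddGroundEnergy ((83 / 100 : ℝ)))
    (h₂ : ∀ a : ℝ, (83 / 100 : ℝ) < a → WeilWindowSimpleEven a) : NoParityCrossing :=
  noParityCrossing_of_beyond_83_of_oddLower hUL hL fun a ha ↦
    ((weilWindowSimpleEven_iff_weilEvenGroundEnergy_lt
      (pos_83.trans ha)).1 (h₂ a ha)).ne

/-- **`GroundStateSimpleEven` (stmt-RiemannHypothesis-1526) ↔ no parity tie beyond `83/100`**, from the odd endpoint bound.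
[folklore] -/
theorem groundStateSimpleEven_iff_noParityCrossingBeyond_83_of_oddLower {L : ℝ}
    (hUL : (1 / 100000000000000000 : ℝ) < L) (hL : L ≤ weilOddGroundEnergy ((83 / 100 : ℝ))) :
    GroundStateSimpleEven ↔ ∀ a : ℝ, (83 / 100 : ℝ) < a → weilEvenGroundEnergy a ≠ weilOddGroundEnergy a :=
  GroundStateSimpleEven.groundStateSimpleEven_iff_noParityCrossing.trans
    (noParityCrossing_iff_beyond_83_of_oddLower hUL hL)

/-- **`GroundStateSimpleEven` ↔ Connes' clause on the tail `a > 83/100`**, from the odd endpoint bound. [folklore] -/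
theorem groundStateSimpleEven_iff_tailSimpleEven_83_of_oddLower {L : ℝ}
    (hUL : (1 / 100000000000000000 : ℝ) < L) (hL : L ≤ weilOddGroundEnergy ((83 / 100 : ℝ))) :
    GroundStateSimpleEven ↔ ∀ a : ℝ, (83 / 100 : ℝ) < a → WeilWindowSimpleEven a := by
  refine ⟨fun h a ha ↦ h a (pos_83.trans ha), fun h a ha ↦ ?_⟩
  rcases le_or_gt a ((83 / 100 : ℝ)) with hle | hlt
  · exact weilWindowSimpleEven_upTo_83_of_oddLower hUL hL a ha hle
  · exact h a hlt

/-- **The crux `EvenWinsBeyondArch` from "no tie beyond `83/100`"**, given the odd endpoint bound. [folklore] -/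
theorem evenWinsBeyondArch_of_noTie_beyond_83_of_oddLower {L : ℝ} (hUL : (1 / 100000000000000000 : ℝ) < L)
    (hL : L ≤ weilOddGroundEnergy ((83 / 100 : ℝ)))
    (hne : ∀ a : ℝ, (83 / 100 : ℝ) < a → weilEvenGroundEnergy a ≠ weilOddGroundEnergy a) : EvenWinsBeyondArch :=
  evenWinsBeyondArch_of_subs WeilParity.onePrimeWindowSimpleEven_proof
    (noParityCrossing_of_beyond_83_of_oddLower hUL hL hne)

/-- **What the crux still asserts**: `EvenWinsBeyondArch ↔ ∀ a > 83/100, ε_ev(a) ≤ ε_od(a)`, given the odd endpoint bound.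
[folklore] -/
theorem evenWinsBeyondArch_iff_forall_le_beyond_83_of_oddLower {L : ℝ} (hUL : (1 / 100000000000000000 : ℝ) < L)
    (hL : L ≤ weilOddGroundEnergy ((83 / 100 : ℝ))) :
    EvenWinsBeyondArch ↔ ∀ a : ℝ, (83 / 100 : ℝ) < a → weilEvenGroundEnergy a ≤ weilOddGroundEnergy a := by
  rw [evenWinsBeyondArch_iff_forall_le]
  refine ⟨fun h a ha ↦ h a (log_two_half_lt_83.trans ha), fun h a ha ↦ ?_⟩
  rcases le_or_gt a ((83 / 100 : ℝ)) with hle | hlt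
  · exact (weilEvenGroundEnergy_lt_weilOddGroundEnergy_of_le_83_of_oddLower hUL hL
      (log_two_half_pos.trans ha) hle).le
  · exact h a hlt

/-- **A failure of the crux forces an exact parity tie at some window beyond `83/100`**, given the odd endpoint
bound. [folklore] -/
theorem exists_tie_beyond_83_of_not_evenWinsBeyondArch_of_oddLower {L : ℝ}
    (hUL : (1 / 100000000000000000 : ℝ) < L) (hL : L ≤ weilOddGroundEnergy ((83 / 100 : ℝ)))
    (h : ¬ EvenWinsBeyondArch) :
    ∃ a : ℝ, (83 / 100 : ℝ) < a ∧ weilEvenGroundEnergy a = weilOddGroundEnergy a := by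
  by_contra hne
  push Not at hne
  exact h (evenWinsBeyondArch_of_noTie_beyond_83_of_oddLower hUL hL hne)

end Summit.RiemannHypothesis.RiemannHypothesis.Theorems.EvenWinsBeyondArch

namespace Summit.RiemannHypothesis.RiemannHypothesis.Theorems.GroundBarta

open Literature.NumberTheory.LFunctions

/-- **GroundBarta's rung 4 from "no tie beyond `83/100`"**, given the odd endpoint bound (transport along
`GroundBarta.evenWinsBeyondArch_iff_weilParity`). [folklore] -/
theorem evenWinsBeyondArch_of_noTie_beyond_83_of_oddLower {L : ℝ} (hUL : (1 / 100000000000000000 : ℝ) < L)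
    (hL : L ≤ weilOddGroundEnergy ((83 / 100 : ℝ)))
    (hne : ∀ a : ℝ, (83 / 100 : ℝ) < a → weilEvenGroundEnergy a ≠ weilOddGroundEnergy a) :
    Summit.RiemannHypothesis.RiemannHypothesis.Theses.GroundBarta.EvenWinsBeyondArch :=
  evenWinsBeyondArch_iff_weilParity.2
    (EvenWinsBeyondArch.evenWinsBeyondArch_of_noTie_beyond_83_of_oddLower hUL hL hne)

/-- **What GroundBarta's rung 4 still asserts**: `↔ ∀ a > 83/100, ε_ev(a) ≤ ε_od(a)`, given the odd endpoint bound.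
[folklore] -/
theorem evenWinsBeyondArch_iff_forall_le_beyond_83_of_oddLower {L : ℝ} (hUL : (1 / 100000000000000000 : ℝ) < L)
    (hL : L ≤ weilOddGroundEnergy ((83 / 100 : ℝ))) :
    Summit.RiemannHypothesis.RiemannHypothesis.Theses.GroundBarta.EvenWinsBeyondArch ↔
      ∀ a : ℝ, (83 / 100 : ℝ) < a → weilEvenGroundEnergy a ≤ weilOddGroundEnergy a :=
  evenWinsBeyondArch_iff_weilParity.trans
    (EvenWinsBeyondArch.evenWinsBeyondArch_iff_forall_le_beyond_83_of_oddLower hUL hL)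

end Summit.RiemannHypothesis.RiemannHypothesis.Theorems.GroundBarta

end
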